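import Mathlib
import HarnessLib
import Summits.HubbardSuperconductivity.HubbardSuperconductivity.Theorems.KLProgrammeKLRegimeTwoVolumePairingBound
import Literature.MathematicalPhysics.QuantumLattice.GrassmannWickLocalised
import Literature.MathematicalPhysics.QuantumLattice.GrassmannKernelMeanValue
import Literature.MathematicalPhysics.QuantumLattice.GrassmannPolchinskiEquation
import Literature.MathematicalPhysics.QuantumLattice.GrassmannNearIdentityStep
import Literature.MathematicalPhysics.QuantumLattice.GrassmannGramFormAlgebra

/-!
# Route `KLProgramme` — crux K3, the nested two-volume pass ((E3f)₀ of stmt-HubbardSuperconductivity-19918 / (N) of the VL child):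
# THE FAR-SUPPORTED COVARIANCE STEP — `effAction D W − W` at a pin far from the support of `D` costs first moments over the distance
# (cell gate-hubbard-kl, seat hubbard-kl-k3c5-p2 g5; mechanism β′ «semigroup defect», VL-TWO-VOLUME-MECHANISMS.md §4)

WHAT.  One abstract theorem of the β′ chain.  Let `D` be a covariance supported on `Zs × Zs` (`D X Y = 0` unless `X, Y ∈ Zs`), with sup entry
`≤ sD` and plain row/column sums `≤ cR, cC`, and let the pin value `w` be at "distance" `≥ R` from `Zs` (`R ≤ d X` on `Zs`, `d ≥ 0`).  Along the
straight path `s ↦ 𝒱_s := effAction (s • D) W` (`s ∈ [0,1]`, `𝒱_0 = W`, `𝒱_1 = effAction D W`) the tree's Polchinski equation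
(`GrassmannPolchinskiEquation.hasCoeffDerivAt_effAction_flow`: `∂_s 𝒱_s = Δ_D 𝒱_s − ½(δ𝒱_s/δψ, D δ𝒱_s/δψ) − [·]_∅`) and the mean-value bound for
pinned kernel sums (`GrassmannKernelMeanValue.sum_norm_kernel_sub_le_of_hasCoeffDerivAt`) reduce the pinned `L¹` kernels of `effAction D W − W` at `w`
to those of the right side, uniformly in `s`; the contraction term is `GrassmannWickLocalised.sum_norm_kernel_grassmannLaplacian_le_of_far`
(`(n+2)(n+3)/2 · (sD/R) ·` first moment of the degree-`n+3` kernel between the pin and the contracted leg) and the bilinear term is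
`…TwoVolumePairingBound.sum_norm_kernel_bilinear_le_of_far` (first moments over `R` against leg-`0`-pinned norms):

* **`sum_norm_kernel_effAction_sub_self_le_of_far`** — given, UNIFORMLY IN `s ∈ [0,1]`, a non-vanishing partition function and kernel data of `𝒱_s`
  (leg-`0`-pinned bounds `nV`, `d`-first moments `mV` pinned at `w` in the two leg conventions), for every degree `n+1` and pin position `p`:
  `Σ_{X : X_p = w} ‖kernel (effAction D W) (n+1) X − kernel W (n+1) X‖ ≤ (n+2)(n+3)/2·(sD/R)·mL(n+3)
     + ‖2⁻¹‖·Σ_{a+b=n+1} (a+1)(b+1)·(cR·(mV(a+1)/R)·nV(b+1) + cC·nV(a+1)·(mV(b+1)/R))` — i.e. `O(1/R)`.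

In the nested two-volume comparison `D = D_far` is the boundary-zone part of the defect covariance `C_{bL} − C^dec`, `R = L/4`, and the kernel data of
`𝒱_s` come from the scale-0 bounds at the interpolated covariances (Gram form: `Literature…GrassmannGramFormAlgebra`).  Everything is proved; no
definition, no named fact; nothing is asserted about the model.
-/

noncomputable section

namespace Summit.HubbardSuperconductivity.HubbardSuperconductivity.Theorems.TwoVolumeDefect

set_option linter.dupNamespace false -- summit = problem name (single-conjunct summit), D-0017

open Finset Literature.MathematicalPhysics.QuantumLattice GrassmannAlgebra

variable {𝕜 : Type*} [RCLike 𝕜] {Γ : Type*} [LinearOrder Γ] [Fintype Γ]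

omit [LinearOrder Γ] [Fintype Γ] in
/-- Kernels of positive degree do not see scalars. [folklore] -/
theorem kernel_sub_sub_smul_one_succ (A B : GrassmannAlgebra 𝕜 Γ) (c : 𝕜) (n : ℕ) (X : Fin (n + 1) → Γ) :
    kernel 𝕜 (A - B - c • (1 : GrassmannAlgebra 𝕜 Γ)) (n + 1) X = kernel 𝕜 A (n + 1) X - kernel 𝕜 B (n + 1) X := by
  have h1 : kernel 𝕜 (c • (1 : GrassmannAlgebra 𝕜 Γ)) (n + 1) X = 0 := by
    rw [kernel_smul, show (1 : GrassmannAlgebra 𝕜 Γ) = algebraMap 𝕜 _ 1 from (map_one _).symm,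
      kernel_algebraMap_eq_zero (𝕜 := 𝕜) (Γ := Γ) (1 : 𝕜) (Nat.succ_pos n) X, mul_zero]
  rw [sub_eq_add_neg, sub_eq_add_neg, kernel_add, kernel_add, ← neg_one_smul 𝕜 B, kernel_smul, ← neg_one_smul 𝕜 (c • _), kernel_smul, h1]
  ring

/-- **THE FAR-SUPPORTED COVARIANCE STEP.**  See the module docstring: `effAction D W − W` at a pin value `w` at distance `≥ R` from the support
zone of `D` has pinned `L¹` kernels `O(1/R)`, the constant being first moments and leg-`0`-pinned norms of the interpolated effective actions
`𝒱_s = effAction (s•D) W`, `s ∈ [0,1]` (Polchinski + mean value + the two far kernel bounds). [folklore; Salmhofer 1998 §3.1 Prop. 1, §4.1] -/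
theorem sum_norm_kernel_effAction_sub_self_le_of_far (D : Matrix Γ Γ 𝕜) (W : GrassmannAlgebra 𝕜 Γ)
    (hW0 : constPart 𝕜 W = 0) (hWe : W ∈ evenOdd 𝕜 0)
    (hZ : ∀ s ∈ Set.Icc (0 : ℝ) 1, effPartitionFn 𝕜 (s • D) W ≠ 0)
    {Zs : Set Γ} [DecidablePred (· ∈ Zs)] (hfar : ∀ X Y, ¬ (X ∈ Zs ∧ Y ∈ Zs) → D X Y = 0)
    {sD : ℝ} (hsD0 : 0 ≤ sD) (hsD : ∀ X Y, ‖D X Y‖ ≤ sD)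
    {cR cC : ℝ} (hcR : 0 ≤ cR) (hcC : 0 ≤ cC) (hR : ∀ X, ∑ Y, ‖D X Y‖ ≤ cR) (hC : ∀ Y, ∑ X, ‖D X Y‖ ≤ cC)
    (d : Γ → ℝ) (hd0 : ∀ X, 0 ≤ d X) {R : ℝ} (hRpos : 0 < R) (hdR : ∀ X, X ∈ Zs → R ≤ d X) (w : Γ)
    (nV mV mL : ℕ → ℝ) (hnV : ∀ m, 0 ≤ nV m) (hmV : ∀ m, 0 ≤ mV m)
    (hV0 : ∀ s ∈ Set.Icc (0 : ℝ) 1, ∀ (m : ℕ) (x : Γ),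
      ∑ U ∈ univ.filter (fun U : Fin (m + 1) → Γ => U 0 = x), ‖kernel 𝕜 (effAction 𝕜 (s • D) W) (m + 1) U‖ ≤ nV (m + 1))
    (hVm : ∀ s ∈ Set.Icc (0 : ℝ) 1, ∀ (m : ℕ) (i : Fin m),
      ∑ U ∈ univ.filter (fun U : Fin (m + 1) → Γ => U i.succ = w), d (U 0) * ‖kernel 𝕜 (effAction 𝕜 (s • D) W) (m + 1) U‖ ≤ mV (m + 1))
    (n : ℕ) (p : Fin (n + 1))
    (hVL : ∀ s ∈ Set.Icc (0 : ℝ) 1,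
      ∑ Z ∈ univ.filter (fun Z : Fin (n + 1 + 1 + 1) → Γ => Z (Fin.castSucc (Fin.castSucc p)) = w),
        d (Z (Fin.last (n + 1 + 1))) * ‖kernel 𝕜 (effAction 𝕜 (s • D) W) (n + 1 + 2) Z‖ ≤ mL (n + 3)) :
    ∑ X ∈ univ.filter (fun X : Fin (n + 1) → Γ => X p = w),
        ‖kernel 𝕜 (effAction 𝕜 D W) (n + 1) X - kernel 𝕜 W (n + 1) X‖ ≤
      (((n + 1 + 1) * (n + 1 + 2) : ℕ) : ℝ) / 2 * (sD / R) * mL (n + 3) +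
        ‖(2 : 𝕜)⁻¹‖ * ∑ a ∈ range (n + 2), ∑ b ∈ range (n + 2),
          (if a + b = n + 1 then (((a + 1) * (b + 1) : ℕ) : ℝ) *
            (cR * (mV (a + 1) / R) * nV (b + 1) + cC * nV (a + 1) * (mV (b + 1) / R)) else 0) := by
  -- the path and Polchinski's equation along it
  set V : ℝ → GrassmannAlgebra 𝕜 Γ := fun s => effAction 𝕜 (s • D) W with hV
  set RHS : ℝ → GrassmannAlgebra 𝕜 Γ := fun s =>
    grassmannLaplacian 𝕜 D (V s) - (2 : 𝕜)⁻¹ • grassmannDerivPairing 𝕜 D (V s) (V s)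
      - constPart 𝕜 (grassmannLaplacian 𝕜 D (V s) - (2 : 𝕜)⁻¹ • grassmannDerivPairing 𝕜 D (V s) (V s)) • 1 with hRHS
  have hpath : ∀ X Y (t : ℝ), HasDerivAt (fun r : ℝ => (r • D) X Y) (D X Y) t := by
    intro X Y t
    have h := (hasDerivAt_id t).smul_const (D X Y)
    simpa [Matrix.smul_apply] using h
  have hderiv : ∀ s ∈ Set.Icc (0 : ℝ) 1, HasCoeffDerivAt V (RHS s) s := fun s hs =>
    (hasCoeffDerivAt_effAction_flow (C := fun r : ℝ => r • D) (fun X Y => hpath X Y s) hW0 hWe (hZ s hs)).1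
  -- endpoints
  have hV1 : V 1 = effAction 𝕜 D W := by simp [hV]
  have hV0' : V 0 = W := by
    simp only [hV, zero_smul]
    exact effAction_zero_cov 𝕜 W hW0
  -- the pinned kernel bound of the right side, uniformly in `s`
  set B : ℝ := (((n + 1 + 1) * (n + 1 + 2) : ℕ) : ℝ) / 2 * (sD / R) * mL (n + 3) +
    ‖(2 : 𝕜)⁻¹‖ * ∑ a ∈ range (n + 2), ∑ b ∈ range (n + 2),
      (if a + b = n + 1 then (((a + 1) * (b + 1) : ℕ) : ℝ) *
        (cR * (mV (a + 1) / R) * nV (b + 1) + cC * nV (a + 1) * (mV (b + 1) / R)) else 0) with hB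
  have hbound : ∀ s ∈ Set.Icc (0 : ℝ) 1,
      ∑ X ∈ univ.filter (fun X : Fin (n + 1) → Γ => X p = w), ‖kernel 𝕜 (RHS s) (n + 1) X‖ ≤ B := by
    intro s hs
    -- contraction term
    have hlap := sum_norm_kernel_grassmannLaplacian_le_of_far D (Zs := Zs) (fun A B' hA => hfar A B' (fun h => hA h.1)) hsD0 hsD
      (fun (_ : Γ) A => d A) (fun _ A => hd0 A) hRpos w (fun A hA => hdR A hA) (V s) (n + 1) p
    -- bilinear term
    have hbil := sum_norm_kernel_bilinear_le_of_far D hfar hcR hcC hR hC d hd0 hRpos hdR (V s) (V s) w nV nV mV mV hmV hmV hnV hnV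
      (hV0 s hs) (hV0 s hs) (hVm s hs) (hVm s hs) n p
    calc ∑ X ∈ univ.filter (fun X : Fin (n + 1) → Γ => X p = w), ‖kernel 𝕜 (RHS s) (n + 1) X‖
        = ∑ X ∈ univ.filter (fun X : Fin (n + 1) → Γ => X p = w),
            ‖kernel 𝕜 (grassmannLaplacian 𝕜 D (V s)) (n + 1) X -
              (2 : 𝕜)⁻¹ * kernel 𝕜 (grassmannDerivPairing 𝕜 D (V s) (V s)) (n + 1) X‖ := by
          refine sum_congr rfl fun X _ => ?_
          rw [hRHS]
          simp only
          rw [kernel_sub_sub_smul_one_succ, kernel_smul]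
      _ ≤ ∑ X ∈ univ.filter (fun X : Fin (n + 1) → Γ => X p = w),
            (‖kernel 𝕜 (grassmannLaplacian 𝕜 D (V s)) (n + 1) X‖ +
              ‖(2 : 𝕜)⁻¹‖ * ‖kernel 𝕜 (grassmannDerivPairing 𝕜 D (V s) (V s)) (n + 1) X‖) :=
          sum_le_sum fun X _ => (norm_sub_le _ _).trans (by rw [norm_mul])
      _ = ∑ X ∈ univ.filter (fun X : Fin (n + 1) → Γ => X p = w), ‖kernel 𝕜 (grassmannLaplacian 𝕜 D (V s)) (n + 1) X‖ +
            ‖(2 : 𝕜)⁻¹‖ * ∑ X ∈ univ.filter (fun X : Fin (n + 1) → Γ => X p = w),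
              ‖kernel 𝕜 (grassmannDerivPairing 𝕜 D (V s) (V s)) (n + 1) X‖ := by
          rw [sum_add_distrib, mul_sum]
      _ ≤ B := by
          rw [hB]
          refine add_le_add (hlap.trans ?_) (mul_le_mul_of_nonneg_left ?_ (norm_nonneg _))
          · exact mul_le_mul_of_nonneg_left (hVL s hs) (by positivity)
          · rw [grassmannDerivPairing_apply] at *
            exact hbil
  -- mean value
  have hmvt := sum_norm_kernel_sub_le_of_hasCoeffDerivAt hderiv (n + 1) (univ.filter (fun X : Fin (n + 1) → Γ => X p = w)) hbound
  rw [hV1, hV0'] at hmvt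
  exact hmvt

/-! ## §2 The partition functions along the path `s • D` are units (from a Gram form of `D` and the scale smallness) -/

omit [LinearOrder Γ] in
open scoped InnerProductSpace in
/-- **`Z(s•D, W)` is a unit for every `s ∈ [0,1]`** when `D` has a charged Gram form with constant `κ`, row/column sums `≤ α`, and the input `W`
(even, no constant part, even-degree pinned profile `N`) satisfies the single-scale smallness `eα‖W‖_h/κ² < 1`: the Gram bound of `s • D` is again
`κ` (`isGramBoundedR_smul_of_gram`), its row sums are `≤ α`, so `GrassmannEffectiveActionTruncationDB` applies at every `s`.  Discharges the `hZ`
hypothesis of `sum_norm_kernel_effAction_sub_self_le_of_far`. [folklore; BGM 2006 (2.77)–(2.80)] -/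
theorem effPartitionFn_smul_isUnit_of_gram {E : Type*} [NormedAddCommGroup E] [InnerProductSpace 𝕜 E] [DecidableEq Γ]
    (D : Matrix Γ Γ 𝕜) (q : Γ → Bool) (hq : ∀ X Y, q X = q Y → D X Y = 0) (f g : Γ → E) {κ : ℝ} (hκ : 0 < κ)
    (hf : ∀ X, q X = true → ‖f X‖ ≤ κ) (hg : ∀ Y, q Y = false → ‖g Y‖ ≤ κ)
    (hG : ∀ X Y, q X = true → q Y = false → contr 𝕜 D X Y = ⟪f X, g Y⟫_𝕜)
    (W : GrassmannAlgebra 𝕜 Γ) (hWe : W ∈ evenPart 𝕜 Γ) (hW0 : constPart 𝕜 W = 0) (N : ℕ → ℝ) (hN0 : ∀ m', 0 ≤ N m')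
    (hN : ∀ m' (j : Fin (2 * m')) (x : Γ), ∑ Y ∈ univ.filter (fun Y : Fin (2 * m') → Γ => Y j = x), ‖kernel 𝕜 W (2 * m') Y‖ ≤ N m')
    {α : ℝ} (hα : 0 < α) (hrow : ∀ X, ∑ Y, ‖D X Y‖ ≤ α) (hcol : ∀ Y, ∑ X, ‖D X Y‖ ≤ α) {ρ : ℝ} (hρ : 0 < ρ)
    (hθ : Real.exp 1 * α * normV Γ κ ρ N / κ ^ 2 < 1) {s : ℝ} (hs : s ∈ Set.Icc (0 : ℝ) 1) :
    effPartitionFn 𝕜 (s • D) W ≠ 0 := by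
  have hGB : IsGramBoundedR (s • D) κ := isGramBoundedR_smul_of_gram q D hq f g hκ.le hf hg hG hs.1 hs.2
  have hsn : ∀ X Y, ‖(s • D) X Y‖ ≤ ‖D X Y‖ := fun X Y => by
    rw [Matrix.smul_apply, norm_smul, Real.norm_eq_abs, abs_of_nonneg hs.1]
    exact (mul_le_mul_of_nonneg_right hs.2 (norm_nonneg _)).trans_eq (one_mul _)
  have hrow' : ∀ X, ∑ Y, ‖(s • D) X Y‖ ≤ α := fun X => (sum_le_sum fun Y _ => hsn X Y).trans (hrow X)
  have hcol' : ∀ Y, ∑ X, ‖(s • D) X Y‖ ≤ α := fun Y => (sum_le_sum fun X _ => hsn X Y).trans (hcol Y)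
  exact ((sum_norm_kernel_effAction_sub_gaussConv_le_of_gramBounded (s • D) hκ hGB W hWe hW0 N hN0 hN hα hrow' hcol' hρ hθ).1).ne_zero

end Summit.HubbardSuperconductivity.HubbardSuperconductivity.Theorems.TwoVolumeDefect

end
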